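/-
Copyright (c) 2026 the pub-hodgecm-mathlib formalisation cell (harness21).  Prover seat hodgecm-mathlib-K2E2-p12 (g5): Track B «K2-LIT», ENGINE E1,
h413 = stmt-HodgeConjecture-24833; (q10) «R7₃-SCALAR» FILE 3, brick (3-iii-b1) «LOCAL MEANS AT THE CM PAIR» (FILE 3 census 2026-09-04T08:25Z, dealer K2E1-plan (g5) «=» 08:27Z).
-/
import Summits.HodgeConjecture.HodgeConjecture.Theorems.K2E1IntertwiningLocalHeightU3             -- ★ (3-iii-a): the local height `Q_v`, continuity, `= 1` on `𝒪_v³`, inert local mean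
import Summits.HodgeConjecture.HodgeConjecture.Theorems.K2E1QuadraticHeckeCharCMPlaceValues          -- ★ `ε_v = −1` inert ∕ `+1` split
import Summits.HodgeConjecture.HodgeConjecture.Theorems.K2E1IntertwiningLocalMeanSplitU3             -- ★ (3-ii) (K2-defs1 g5): `integral_splitCell_pi_eq_localScalar`, `integrable_splitCell_pi`, `mul_rpow_neg_max_one`
import Literature.NumberTheory.NumberFields.QuadraticCompletionIntegralBasis                         -- ★ `ramificationIdx'_eq_one_of_isUnramifiedIn`
import Literature.NumberTheory.Automorphic.FiniteAdeleFactorizable                                   -- ★ `integralBox`, `mem_integralBox_iff`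
import Literature.NumberTheory.Automorphic.GlobalAdditiveCharacter                                   -- ★ `mem_primePowBall_zero_iff` (`𝒪_v = 𝔭⁰`)
import HarnessLib

/-!
# K2·E1 — `K2E1IntertwiningLocalMeanCMU3` ((q10) «R7₃-SCALAR» FILE 3, brick (3-iii-b1)): THE LOCAL MEANS OF THE `U(2,1)` INTERTWINING INTEGRAND AT THE CM PAIR, IN FILE 1's
# COMPLEX CURRENCY — at a good place `v` of `L⁺` (unramified in `L`, `v ∤ 2`, `δ` a unit): `ν(𝒪_v³)⁻¹·∫ Q_v^{−σ} d(ν⊗ν⊗ν) = [(1−q_v^{−σ})(1−ε_v q_v^{−σ})(1−ε_v q_v^{−(2σ−1)})]∕[(1−q_v^{−(σ−1)})(1−ε_v q_v^{−(σ−1)})(1−ε_v q_v^{−(2σ−2)})]`,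
# `ε_v = ε_{L∕L⁺}(ϖ_v)` — BOTH inert (★ (3-iii-a)) and split (★ (3-ii) `K2E1IntertwiningLocalMeanSplitU3`, K2-defs1 (g5)) places; plus `Q_v = 1` on `𝒪_v³` (`hf1`) and continuity (`hcont`) in `ℂ`

Track B ∕ K2-LIT, crux h413 = `stmt-HodgeConjecture-24833`, route of record `HCCMUnconditional`; cell `hodgecm-mathlib`, squad K2, ENGINE E1 (campaign «EIS-RANK-ONE», R7 at
`N = 3`).  THEOREMS ONLY (no `def`, no instance, no notation, no `sorry`; default heartbeats); lane `--supports stmt-HodgeConjecture-24833 --as helper` (count-neutral).  CM pair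
`L ∕ L⁺`, `c` = complex conjugation, `δ ∈ L⁻ ∖ 0` (`cδ = −δ`, `δ² = d ∈ L⁺`), `ε = quadraticHeckeCharCM L`; `Q_v` = the local height of ★ `K2E1IntertwiningLocalHeightU3` (written out).
* §1 `placesOver_good`: at a place `v` UNRAMIFIED in `L` every `w ∣ v` has `e(w∣v) = 1` (★ `ramificationIdx'_eq_one_of_isUnramifiedIn`) and, if non-split, `q_w = q_v²`
  (★ `Rogawski1990.absNorm_placesOver_eq_sq_of_nonsplit_of_isUnramifiedIn`).
* §2 **`localHeight_eq_one_of_mem_integralBox`** — at a good `v` (unramified, `|2|_v = 1`, `|δ_w|_w = 1` for all `w ∣ v`), `Q_v = 1` on `integralBox L⁺ (Fin 3) v` (inert ★ ∕ split ★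
  cases of (3-iii-a)); `ofReal_localHeight_rpow_eq_one_of_mem_integralBox` ∕ `continuous_ofReal_localHeight_rpow` — the `hf1` ∕ `hcont` letters of
  ★ `AdelicProductIntegral.hasProd_localIntegral_of_integrable`, literally, in `ℂ`.
* §3 **`ofReal_localScalarShape`** — the real token shape cast to `ℂ`: `(([(1−q^{−σ})(1−e q^{−σ})(1−e q^{−(2σ−1)})]∕[…] : ℝ) : ℂ) =` the same with `(q : ℂ)^{−(σ:ℂ)}` and `(e : ℂ)` (`e = ∓1`).
* §4 `pi_integralBox_toReal` (`(ν⊗ν⊗ν)(𝒪_v³) = ν(𝒪_v)³`); **`integral_localHeight_rpow_eq_localScalar_of_split`** + `integrable_localHeight_rpow_of_split` (★ (3-iii-a)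
  `localHeight_rpow_eq_gl3_of_split` then ★ (3-ii) `K2E1IntertwiningLocalMeanSplitU3.integral_splitCell_pi_eq_localScalar` ∕ `integrable_splitCell_pi`, K2-defs1 (g5), at `δ₁ = δ_w`);
  `integrable_localHeight_rpow` (every good `v`); **`localMean_eq_localScalar_of_nonsplit`** ∕ **`_of_split`** ∕ **`localMean_eq_localScalar`**: at a good `v`,
  `(ν(𝒪_v³))⁻¹ • ∫ ((Q_v^{−σ} : ℝ) : ℂ) d(pi ν) =` FILE 1's complex `v`-factor with `ε_v = ε.valueAtUniformizer v` (`= −1` inert ★ `valueAtUniformizer_quadraticHeckeCharCM_of_nonsplit`,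
  `= +1` split ★ `…_of_split`) — LITERALLY the `v`-term of ★ FILE 1 `K2E1IntertwiningScalarContinuationU3.hasProd_localScalar_three_cm` at `σ ↦ (σ : ℂ)`.
HONEST LABEL: HC_CM is proved only modulo the 7 printed citations (2 remaining named inputs: hLiu418 = `stmt-HodgeConjecture-24832`, h413 = `stmt-HodgeConjecture-24833`) until rung 0
closes; this file asserts no named fact and closes no socket; count-neutral; unconditional local algebra ∕ measure theory.

## References
* [Langlands1971] R. P. Langlands, *Euler Products* (1971): §3.
* [Rogawski1990] J. D. Rogawski, *Automorphic Representations of Unitary Groups in Three Variables* (1990): §4.5.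
* [MoeglinWaldspurger1995] C. Mœglin, J.-L. Waldspurger, *Spectral Decomposition and Eisenstein Series* (1995): II.1.7, IV.1.11.
* [TateThesis1967] J. Tate, *Fourier analysis in number fields and Hecke's zeta-functions* (1967): §3.3.
-/

set_option autoImplicit false
set_option linter.dupNamespace false -- the mandated namespace repeats `HodgeConjecture.HodgeConjecture`

noncomputable section

open MeasureTheory NumberField IsDedekindDomain
open scoped NNReal ENNReal
open Literature.NumberTheory.Automorphic Literature.NumberTheory.Automorphic.UnitaryGroup Literature.NumberTheory.GaloisRepresentations
open Literature.NumberTheory.GaloisRepresentations.IsNonarchimedeanLocalField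
open Literature.NumberTheory.GelbartRogawski1991.UnitaryDualPair.LocalSplitting (splitSqrt)
open Summit.HodgeConjecture.HodgeConjecture.Cruxes.H413.K2E1IntertwiningLocalHeightU3
open Summit.HodgeConjecture.HodgeConjecture.Cruxes.H413.K2E1QuadraticHeckeCharCMPlaceValues
open Summit.HodgeConjecture.HodgeConjecture.Cruxes.H413.K2E1IntertwiningLocalMeanSplitU3 (integral_splitCell_pi_eq_localScalar integrable_splitCell_pi
  mul_rpow_neg_max_one)

namespace Summit.HodgeConjecture.HodgeConjecture.Cruxes.H413.K2E1IntertwiningLocalMeanCMU3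

variable (L : Type) [Field L] [NumberField L] [IsCMField L] {δ : L} (hcδ : IsCMField.complexConj L δ = -δ) (hδ : δ ≠ 0)
  {d : ↥(maximalRealSubfield L)} (hd : δ * δ = algebraMap ↥(maximalRealSubfield L) L d)
  (v : HeightOneSpectrum (𝓞 ↥(maximalRealSubfield L)))

/-! ## §1 Good places: `e(w∣v) = 1`, and `q_w = q_v²` at non-split ones -/

/-- At a place unramified in `L`: `e(w∣v) = 1` for every `w ∣ v`; if moreover `v` is non-split then `q_w = q_v²`. [cite: Rogawski1990, §4.5] -/
theorem placesOver_good (hunr : Algebra.IsUnramifiedIn (𝓞 L) v.asIdeal) (w : PlacesOver L v) :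
    v.asIdeal.ramificationIdx' w.1.asIdeal = 1 ∧ (IsCMField.complexConj L • w.1 = w.1 → w.1.residueCard = v.residueCard ^ 2) :=
  ⟨Literature.NumberTheory.NumberFields.ramificationIdx'_eq_one_of_isUnramifiedIn L v w hunr,
    fun hw => Literature.NumberTheory.Rogawski1990.absNorm_placesOver_eq_sq_of_nonsplit_of_isUnramifiedIn L v w hw hunr⟩

/-! ## §2 `Q_v = 1` on the integral box at a good place -/

include hd in
/-- **`Q_v = 1` ON `integralBox L⁺ (Fin 3) v` AT A GOOD PLACE** (`v` unramified in `L`, `|2|_v = 1`, `|δ_w|_w = 1` for all `w ∣ v`): by cases inert (★ `localHeight_eq_one_of_normAbs_le_one_of_nonsplit`)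
∕ split (★ `…_of_split`, `|δ_w| = |δ| = 1`, `|2⁻¹| = 1`).  This is the `hf1` hypothesis of ★ `AdelicProductIntegral.hasProd_localIntegral_of_integrable`. [cite: Langlands1971, §3] -/
theorem localHeight_eq_one_of_mem_integralBox (hunr : Algebra.IsUnramifiedIn (𝓞 L) v.asIdeal) (h2 : Valued.v (2 : v.adicCompletion ↥(maximalRealSubfield L)) = 1)
    (hδu : ∀ w : PlacesOver L v, Valued.v (algebraMap L (LocalRing L v) δ w) = 1)
    {p : Fin 3 → v.adicCompletion ↥(maximalRealSubfield L)} (hp : p ∈ integralBox ↥(maximalRealSubfield L) (Fin 3) v) :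
    (∏ w' : PlacesOver L v, max 1 (max ((normAbs (w'.1.adicCompletion L) (quadraticLocalEquiv L v (IsCMField.complexConj L) hcδ hδ (p 0, p 1) w') : ℝ≥0) : ℝ)
        ((normAbs (w'.1.adicCompletion L) ((toLocalRing L v (p 2) * algebraMap L (LocalRing L v) δ -
          toLocalRing L v 2⁻¹ * (quadraticLocalEquiv L v (IsCMField.complexConj L) hcδ hδ (p 0, p 1) *
            conjLocal L (IsCMField.complexConj L) v (quadraticLocalEquiv L v (IsCMField.complexConj L) hcδ hδ (p 0, p 1)))) w') : ℝ≥0) : ℝ))) = 1 := by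
  haveI : Algebra.IsQuadraticExtension ↥(maximalRealSubfield L) L := IsCMField.isQuadraticExtension L
  obtain ⟨w⟩ := PlacesOver.nonempty L v
  have hp' : ∀ i, normAbs (v.adicCompletion ↥(maximalRealSubfield L)) (p i) ≤ 1 := fun i =>
    normAbs_le_one_iff.2 (by
      have h := (mem_integralBox_iff.1 hp) i
      exact (mem_primePowBall_zero_iff (p i)).2 h |> fun hm => by rwa [LocalFieldHaar.mem_primePowBall_zero_iff] at hm)
  by_cases hw : IsCMField.complexConj L • w.1 = w.1
  · obtain ⟨he, hq⟩ := placesOver_good L v hunr w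
    exact localHeight_eq_one_of_normAbs_le_one_of_nonsplit L (IsCMField.complexConj L) hcδ hδ hd v w hw he h2 (hδu w) (hq hw) hp'
  · -- split: `|δ_w|_v = |δ|_w = 1` and `|2⁻¹|_v = 1`
    have hval : Valued.v (splitSqrt ↥(maximalRealSubfield L) L (IsCMField.complexConj L) hcδ hδ v w) = 1 := by
      rw [← Literature.NumberTheory.GelbartRogawski1991.UnitaryDualPair.LocalSplitting.valued_toPlace_of_split ↥(maximalRealSubfield L) L
          (IsCMField.complexConj L) v w hw (splitSqrt ↥(maximalRealSubfield L) L (IsCMField.complexConj L) hcδ hδ v w),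
        Literature.NumberTheory.GelbartRogawski1991.UnitaryDualPair.LocalSplitting.toPlace_splitSqrt ↥(maximalRealSubfield L) L (IsCMField.complexConj L)
          hcδ hδ hd v w hw]
      exact hδu w
    have hδ1 : normAbs (v.adicCompletion ↥(maximalRealSubfield L)) (splitSqrt ↥(maximalRealSubfield L) L (IsCMField.complexConj L) hcδ hδ v w) ≤ 1 := by
      rw [← map_one (normAbs (v.adicCompletion ↥(maximalRealSubfield L))), normAbs_le_normAbs_iff_valued, hval, Valuation.map_one]
    have h2' : normAbs (v.adicCompletion ↥(maximalRealSubfield L)) (2⁻¹ : v.adicCompletion ↥(maximalRealSubfield L)) ≤ 1 := by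
      rw [← map_one (normAbs (v.adicCompletion ↥(maximalRealSubfield L))), normAbs_le_normAbs_iff_valued, map_inv₀, h2, inv_one, Valuation.map_one]
    exact localHeight_eq_one_of_normAbs_le_one_of_split L (IsCMField.complexConj L) hcδ hδ hd v w hw hδ1 h2' hp'

include hd in
/-- **THE `hf1` LETTER OF ★ `AdelicProductIntegral.hasProd_localIntegral_of_integrable`, LITERALLY**: at a good place, `((Q_v(z)^{−σ} : ℝ) : ℂ) = 1` for every
`z ∈ integralBox L⁺ (Fin 3) v`. [cite: Langlands1971, §3] -/
theorem ofReal_localHeight_rpow_eq_one_of_mem_integralBox (hunr : Algebra.IsUnramifiedIn (𝓞 L) v.asIdeal)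
    (h2 : Valued.v (2 : v.adicCompletion ↥(maximalRealSubfield L)) = 1) (hδu : ∀ w : PlacesOver L v, Valued.v (algebraMap L (LocalRing L v) δ w) = 1) (σ : ℝ)
    {p : Fin 3 → v.adicCompletion ↥(maximalRealSubfield L)} (hp : p ∈ integralBox ↥(maximalRealSubfield L) (Fin 3) v) :
    (((∏ w' : PlacesOver L v, max 1 (max ((normAbs (w'.1.adicCompletion L) (quadraticLocalEquiv L v (IsCMField.complexConj L) hcδ hδ (p 0, p 1) w') : ℝ≥0) : ℝ)
        ((normAbs (w'.1.adicCompletion L) ((toLocalRing L v (p 2) * algebraMap L (LocalRing L v) δ -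
          toLocalRing L v 2⁻¹ * (quadraticLocalEquiv L v (IsCMField.complexConj L) hcδ hδ (p 0, p 1) *
            conjLocal L (IsCMField.complexConj L) v (quadraticLocalEquiv L v (IsCMField.complexConj L) hcδ hδ (p 0, p 1)))) w') : ℝ≥0) : ℝ))) ^ (-σ) : ℝ) : ℂ) = 1 := by
  rw [localHeight_eq_one_of_mem_integralBox L hcδ hδ hd v hunr h2 hδu hp, Real.one_rpow, Complex.ofReal_one]

/-- **THE `hcont` LETTER, IN `ℂ`**: `p ↦ ((Q_v(p)^{−σ} : ℝ) : ℂ)` is continuous (★ `continuous_localHeight_rpow`). [folklore] -/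
theorem continuous_ofReal_localHeight_rpow (σ : ℝ) :
    Continuous fun p : Fin 3 → v.adicCompletion ↥(maximalRealSubfield L) =>
      (((∏ w' : PlacesOver L v, max 1 (max ((normAbs (w'.1.adicCompletion L) (quadraticLocalEquiv L v (IsCMField.complexConj L) hcδ hδ (p 0, p 1) w') : ℝ≥0) : ℝ)
        ((normAbs (w'.1.adicCompletion L) ((toLocalRing L v (p 2) * algebraMap L (LocalRing L v) δ -
          toLocalRing L v 2⁻¹ * (quadraticLocalEquiv L v (IsCMField.complexConj L) hcδ hδ (p 0, p 1) *
            conjLocal L (IsCMField.complexConj L) v (quadraticLocalEquiv L v (IsCMField.complexConj L) hcδ hδ (p 0, p 1)))) w') : ℝ≥0) : ℝ))) ^ (-σ) : ℝ) : ℂ) :=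
  Complex.continuous_ofReal.comp (continuous_localHeight_rpow L (IsCMField.complexConj L) hcδ hδ v σ)

/-! ## §3 The real token shape cast to `ℂ` -/

omit [NumberField L] [IsCMField L] in
/-- **Casting FILE 2's real token shape to FILE 1's complex one**: for `q > 0`, real `σ` and `e ∈ ℝ`,
`(([(1−q^{−σ})(1−e q^{−σ})(1−e q^{−(2σ−1)})] ∕ [(1−q^{−(σ−1)})(1−e q^{−(σ−1)})(1−e q^{−(2σ−2)})] : ℝ) : ℂ)` is the same expression in `(q:ℂ)^{−(σ:ℂ)}`, `(e:ℂ)` (`Complex.ofReal_cpow`). [folklore] -/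
theorem ofReal_localScalarShape {q : ℝ} (hq : 0 ≤ q) (σ e : ℝ) :
    (((1 - q ^ (-σ)) * (1 - e * q ^ (-σ)) * (1 - e * q ^ (-(2 * σ - 1))) /
        ((1 - q ^ (-(σ - 1))) * (1 - e * q ^ (-(σ - 1))) * (1 - e * q ^ (-(2 * σ - 2)))) : ℝ) : ℂ) =
      (1 - (q : ℂ) ^ (-(σ : ℂ))) * (1 - (e : ℂ) * (q : ℂ) ^ (-(σ : ℂ))) * (1 - (e : ℂ) * (q : ℂ) ^ (-(2 * (σ : ℂ) - 1))) /
        ((1 - (q : ℂ) ^ (-((σ : ℂ) - 1))) * (1 - (e : ℂ) * (q : ℂ) ^ (-((σ : ℂ) - 1))) * (1 - (e : ℂ) * (q : ℂ) ^ (-(2 * (σ : ℂ) - 2)))) := by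
  have h : ∀ s : ℝ, ((q ^ s : ℝ) : ℂ) = (q : ℂ) ^ (s : ℂ) := fun s => Complex.ofReal_cpow hq s
  push_cast
  rw [h, h, h, h]
  push_cast
  ring_nf

section Mean

variable [MeasurableSpace (v.adicCompletion ↥(maximalRealSubfield L))] [BorelSpace (v.adicCompletion ↥(maximalRealSubfield L))]
  (ν : Measure (v.adicCompletion ↥(maximalRealSubfield L))) [ν.IsAddHaarMeasure]

omit [IsCMField L] [BorelSpace (v.adicCompletion ↥(maximalRealSubfield L))] in
/-- `(ν⊗ν⊗ν)(𝒪_v³) = ν(𝒪_v)³` (`integralBox = 𝒪_v^{Fin 3}`, Mathlib `Measure.pi_pi`; `𝒪_v = 𝔭⁰`). [folklore] -/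
theorem pi_integralBox_toReal :
    ((Measure.pi fun _ : Fin 3 => ν) (integralBox ↥(maximalRealSubfield L) (Fin 3) v)).toReal = ν.real (primePowBall (v.adicCompletion ↥(maximalRealSubfield L)) 0) ^ 3 := by
  haveI := secondCountableTopology_localField (v.adicCompletion ↥(maximalRealSubfield L))
  haveI := sigmaCompactSpace_of_isNonarchimedeanLocalField (v.adicCompletion ↥(maximalRealSubfield L))
  have hset : (v.adicCompletionIntegers ↥(maximalRealSubfield L) : Set (v.adicCompletion ↥(maximalRealSubfield L))) =
      primePowBall (v.adicCompletion ↥(maximalRealSubfield L)) 0 := by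
    ext x
    exact (mem_primePowBall_zero_iff x).symm
  rw [integralBox, Measure.pi_pi, Finset.prod_const, Finset.card_univ, Fintype.card_fin, ENNReal.toReal_pow, hset]
  rfl

include hd in
/-- **THE SPLIT LOCAL INTEGRAL IN FILE 1's TOKENS** (`ε = +1`): at a SPLIT `v` with `|2|_v = 1` and `δ_w` a unit, for `σ > 1`,
`∫ Q_v^{−σ} d(ν⊗ν⊗ν) = ν(𝒪_v)³ · [(1−q^{−σ})(1−1·q^{−σ})(1−1·q^{−(2σ−1)})] ∕ [(1−q^{−(σ−1)})(1−1·q^{−(σ−1)})(1−1·q^{−(2σ−2)})]` — ★ (3-iii-a) `localHeight_rpow_eq_gl3_of_split`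
followed by ★ (3-ii) `integral_splitCell_pi_eq_localScalar` (K2-defs1 (g5)) at `δ₁ = δ_w = splitSqrt`. [cite: Langlands1971, §3] [cite: MoeglinWaldspurger1995, II.1.7] -/
theorem integral_localHeight_rpow_eq_localScalar_of_split (w : PlacesOver L v) (hw : IsCMField.complexConj L • w.1 ≠ w.1)
    (h2 : Valued.v (2 : v.adicCompletion ↥(maximalRealSubfield L)) = 1) (hδu : Valued.v (algebraMap L (LocalRing L v) δ w) = 1) {σ : ℝ} (hσ : 1 < σ) :
    ∫ p : Fin 3 → v.adicCompletion ↥(maximalRealSubfield L),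
        (∏ w' : PlacesOver L v, max 1 (max ((normAbs (w'.1.adicCompletion L) (quadraticLocalEquiv L v (IsCMField.complexConj L) hcδ hδ (p 0, p 1) w') : ℝ≥0) : ℝ)
          ((normAbs (w'.1.adicCompletion L) ((toLocalRing L v (p 2) * algebraMap L (LocalRing L v) δ -
            toLocalRing L v 2⁻¹ * (quadraticLocalEquiv L v (IsCMField.complexConj L) hcδ hδ (p 0, p 1) *
              conjLocal L (IsCMField.complexConj L) v (quadraticLocalEquiv L v (IsCMField.complexConj L) hcδ hδ (p 0, p 1)))) w') : ℝ≥0) : ℝ))) ^ (-σ)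
        ∂(Measure.pi fun _ : Fin 3 => ν) =
      ν.real (primePowBall (v.adicCompletion ↥(maximalRealSubfield L)) 0) ^ 3 *
        ((1 - (v.residueCard : ℝ) ^ (-σ)) * (1 - 1 * (v.residueCard : ℝ) ^ (-σ)) * (1 - 1 * (v.residueCard : ℝ) ^ (-(2 * σ - 1))) /
          ((1 - (v.residueCard : ℝ) ^ (-(σ - 1))) * (1 - 1 * (v.residueCard : ℝ) ^ (-(σ - 1))) * (1 - 1 * (v.residueCard : ℝ) ^ (-(2 * σ - 2))))) := by
  haveI : Algebra.IsQuadraticExtension ↥(maximalRealSubfield L) L := IsCMField.isQuadraticExtension L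
  have hval : Valued.v (splitSqrt ↥(maximalRealSubfield L) L (IsCMField.complexConj L) hcδ hδ v w) = 1 := by
    rw [← Literature.NumberTheory.GelbartRogawski1991.UnitaryDualPair.LocalSplitting.valued_toPlace_of_split ↥(maximalRealSubfield L) L
        (IsCMField.complexConj L) v w hw (splitSqrt ↥(maximalRealSubfield L) L (IsCMField.complexConj L) hcδ hδ v w),
      Literature.NumberTheory.GelbartRogawski1991.UnitaryDualPair.LocalSplitting.toPlace_splitSqrt ↥(maximalRealSubfield L) L (IsCMField.complexConj L)
        hcδ hδ hd v w hw]
    exact hδu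
  have hδ1 : normAbs (v.adicCompletion ↥(maximalRealSubfield L)) (splitSqrt ↥(maximalRealSubfield L) L (IsCMField.complexConj L) hcδ hδ v w) = 1 :=
    le_antisymm (by rw [← map_one (normAbs (v.adicCompletion ↥(maximalRealSubfield L))), normAbs_le_normAbs_iff_valued, hval, Valuation.map_one])
      (by rw [← map_one (normAbs (v.adicCompletion ↥(maximalRealSubfield L))), normAbs_le_normAbs_iff_valued, hval, Valuation.map_one])
  have h2' : normAbs (v.adicCompletion ↥(maximalRealSubfield L)) (2 : v.adicCompletion ↥(maximalRealSubfield L)) = 1 :=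
    le_antisymm (by rw [← map_one (normAbs (v.adicCompletion ↥(maximalRealSubfield L))), normAbs_le_normAbs_iff_valued, h2, Valuation.map_one])
      (by rw [← map_one (normAbs (v.adicCompletion ↥(maximalRealSubfield L))), normAbs_le_normAbs_iff_valued, h2, Valuation.map_one])
  rw [← residueFieldCard_adicCompletion_eq, ← integral_splitCell_pi_eq_localScalar ν hδ1 h2' hσ]
  refine integral_congr_ae (Filter.Eventually.of_forall fun p => ?_)
  beta_reduce
  rw [localHeight_rpow_eq_gl3_of_split L (IsCMField.complexConj L) hcδ hδ hd v w hw σ p, mul_rpow_neg_max_one (le_max_left _ _) (le_max_left _ _)]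
  simp only [Matrix.cons_val_zero, Matrix.cons_val_one, Matrix.cons_val_two, Matrix.head_cons, Matrix.tail_cons]

include hd in
/-- **INTEGRABILITY OF `Q_v^{−σ}` AT A SPLIT PLACE** (`|2|_v = 1`, `δ_w` a unit, `σ > 1`): ★ (3-ii) `integrable_splitCell_pi` transported along ★ `localHeight_rpow_eq_gl3_of_split`.
[cite: TateThesis1967, §3.3] -/
theorem integrable_localHeight_rpow_of_split (w : PlacesOver L v) (hw : IsCMField.complexConj L • w.1 ≠ w.1)
    (h2 : Valued.v (2 : v.adicCompletion ↥(maximalRealSubfield L)) = 1) (hδu : Valued.v (algebraMap L (LocalRing L v) δ w) = 1) {σ : ℝ} (hσ : 1 < σ) :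
    Integrable (fun p : Fin 3 → v.adicCompletion ↥(maximalRealSubfield L) =>
        (∏ w' : PlacesOver L v, max 1 (max ((normAbs (w'.1.adicCompletion L) (quadraticLocalEquiv L v (IsCMField.complexConj L) hcδ hδ (p 0, p 1) w') : ℝ≥0) : ℝ)
          ((normAbs (w'.1.adicCompletion L) ((toLocalRing L v (p 2) * algebraMap L (LocalRing L v) δ -
            toLocalRing L v 2⁻¹ * (quadraticLocalEquiv L v (IsCMField.complexConj L) hcδ hδ (p 0, p 1) *
              conjLocal L (IsCMField.complexConj L) v (quadraticLocalEquiv L v (IsCMField.complexConj L) hcδ hδ (p 0, p 1)))) w') : ℝ≥0) : ℝ))) ^ (-σ))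
      (Measure.pi fun _ : Fin 3 => ν) := by
  haveI : Algebra.IsQuadraticExtension ↥(maximalRealSubfield L) L := IsCMField.isQuadraticExtension L
  have hval : Valued.v (splitSqrt ↥(maximalRealSubfield L) L (IsCMField.complexConj L) hcδ hδ v w) = 1 := by
    rw [← Literature.NumberTheory.GelbartRogawski1991.UnitaryDualPair.LocalSplitting.valued_toPlace_of_split ↥(maximalRealSubfield L) L
        (IsCMField.complexConj L) v w hw (splitSqrt ↥(maximalRealSubfield L) L (IsCMField.complexConj L) hcδ hδ v w),
      Literature.NumberTheory.GelbartRogawski1991.UnitaryDualPair.LocalSplitting.toPlace_splitSqrt ↥(maximalRealSubfield L) L (IsCMField.complexConj L)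
        hcδ hδ hd v w hw]
    exact hδu
  have hδ1 : normAbs (v.adicCompletion ↥(maximalRealSubfield L)) (splitSqrt ↥(maximalRealSubfield L) L (IsCMField.complexConj L) hcδ hδ v w) = 1 :=
    le_antisymm (by rw [← map_one (normAbs (v.adicCompletion ↥(maximalRealSubfield L))), normAbs_le_normAbs_iff_valued, hval, Valuation.map_one])
      (by rw [← map_one (normAbs (v.adicCompletion ↥(maximalRealSubfield L))), normAbs_le_normAbs_iff_valued, hval, Valuation.map_one])
  have h2' : normAbs (v.adicCompletion ↥(maximalRealSubfield L)) (2 : v.adicCompletion ↥(maximalRealSubfield L)) = 1 :=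
    le_antisymm (by rw [← map_one (normAbs (v.adicCompletion ↥(maximalRealSubfield L))), normAbs_le_normAbs_iff_valued, h2, Valuation.map_one])
      (by rw [← map_one (normAbs (v.adicCompletion ↥(maximalRealSubfield L))), normAbs_le_normAbs_iff_valued, h2, Valuation.map_one])
  refine (integrable_splitCell_pi ν hδ1 h2' hσ).congr (Filter.Eventually.of_forall fun p => ?_)
  beta_reduce
  rw [localHeight_rpow_eq_gl3_of_split L (IsCMField.complexConj L) hcδ hδ hd v w hw σ p, mul_rpow_neg_max_one (le_max_left _ _) (le_max_left _ _)]
  simp only [Matrix.cons_val_zero, Matrix.cons_val_one, Matrix.cons_val_two, Matrix.head_cons, Matrix.tail_cons]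

include hd in
/-- **INTEGRABILITY OF `Q_v^{−σ}` AT EVERY GOOD PLACE** (`v` unramified in `L`, `|2|_v = 1`, all `δ_w` units; `σ > 1`): inert ★ (3-iii-a) ∕ split (above). [cite: TateThesis1967, §3.3] -/
theorem integrable_localHeight_rpow (hunr : Algebra.IsUnramifiedIn (𝓞 L) v.asIdeal) (h2 : Valued.v (2 : v.adicCompletion ↥(maximalRealSubfield L)) = 1)
    (hδu : ∀ w : PlacesOver L v, Valued.v (algebraMap L (LocalRing L v) δ w) = 1) {σ : ℝ} (hσ : 1 < σ) :
    Integrable (fun p : Fin 3 → v.adicCompletion ↥(maximalRealSubfield L) =>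
        (∏ w' : PlacesOver L v, max 1 (max ((normAbs (w'.1.adicCompletion L) (quadraticLocalEquiv L v (IsCMField.complexConj L) hcδ hδ (p 0, p 1) w') : ℝ≥0) : ℝ)
          ((normAbs (w'.1.adicCompletion L) ((toLocalRing L v (p 2) * algebraMap L (LocalRing L v) δ -
            toLocalRing L v 2⁻¹ * (quadraticLocalEquiv L v (IsCMField.complexConj L) hcδ hδ (p 0, p 1) *
              conjLocal L (IsCMField.complexConj L) v (quadraticLocalEquiv L v (IsCMField.complexConj L) hcδ hδ (p 0, p 1)))) w') : ℝ≥0) : ℝ))) ^ (-σ))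
      (Measure.pi fun _ : Fin 3 => ν) := by
  haveI : Algebra.IsQuadraticExtension ↥(maximalRealSubfield L) L := IsCMField.isQuadraticExtension L
  obtain ⟨w⟩ := PlacesOver.nonempty L v
  by_cases hw : IsCMField.complexConj L • w.1 = w.1
  · obtain ⟨he, hq⟩ := placesOver_good L v hunr w
    exact integrable_localHeight_rpow_of_nonsplit L (IsCMField.complexConj L) hcδ hδ hd v w ν hw he h2 (hδu w) (hq hw) hσ
  · exact integrable_localHeight_rpow_of_split L hcδ hδ hd v ν w hw h2 (hδu w) hσ

include hd in
/-- **THE LOCAL MEAN AT A GOOD NON-SPLIT PLACE IS FILE 1's `v`-FACTOR** (`σ > 1` real): with `ε = quadraticHeckeCharCM L` (`ε_v = −1` here, ★ `valueAtUniformizer_quadraticHeckeCharCM_of_nonsplit`),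
`(ν(𝒪_v³))⁻¹ • ∫ ((Q_v^{−σ} : ℝ) : ℂ) d(ν⊗ν⊗ν) = [(1−q_v^{−σ})(1−ε_v q_v^{−σ})(1−ε_v q_v^{−(2σ−1)})] ∕ [(1−q_v^{−(σ−1)})(1−ε_v q_v^{−(σ−1)})(1−ε_v q_v^{−(2σ−2)})]` in `ℂ` at `σ ↦ (σ : ℂ)` — LITERALLY
the `v`-term of ★ `K2E1IntertwiningScalarContinuationU3.hasProd_localScalar_three_cm`. [cite: Langlands1971, §3] [cite: Rogawski1990, §4.5] [cite: MoeglinWaldspurger1995, IV.1.11] -/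
theorem localMean_eq_localScalar_of_nonsplit (hunr : Algebra.IsUnramifiedIn (𝓞 L) v.asIdeal) (w : PlacesOver L v) (hw : IsCMField.complexConj L • w.1 = w.1)
    (h2 : Valued.v (2 : v.adicCompletion ↥(maximalRealSubfield L)) = 1) (hδu : Valued.v (algebraMap L (LocalRing L v) δ w) = 1) {σ : ℝ} (hσ : 1 < σ) :
    ((Measure.pi fun _ : Fin 3 => ν) (integralBox ↥(maximalRealSubfield L) (Fin 3) v)).toReal⁻¹ •
      ∫ p : Fin 3 → v.adicCompletion ↥(maximalRealSubfield L),
        (((∏ w' : PlacesOver L v, max 1 (max ((normAbs (w'.1.adicCompletion L) (quadraticLocalEquiv L v (IsCMField.complexConj L) hcδ hδ (p 0, p 1) w') : ℝ≥0) : ℝ)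
          ((normAbs (w'.1.adicCompletion L) ((toLocalRing L v (p 2) * algebraMap L (LocalRing L v) δ -
            toLocalRing L v 2⁻¹ * (quadraticLocalEquiv L v (IsCMField.complexConj L) hcδ hδ (p 0, p 1) *
              conjLocal L (IsCMField.complexConj L) v (quadraticLocalEquiv L v (IsCMField.complexConj L) hcδ hδ (p 0, p 1)))) w') : ℝ≥0) : ℝ))) ^ (-σ) : ℝ) : ℂ)
        ∂(Measure.pi fun _ : Fin 3 => ν) =
      (1 - (v.residueCard : ℂ) ^ (-(σ : ℂ))) * (1 - (quadraticHeckeCharCM L).valueAtUniformizer v * (v.residueCard : ℂ) ^ (-(σ : ℂ))) *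
          (1 - (quadraticHeckeCharCM L).valueAtUniformizer v * (v.residueCard : ℂ) ^ (-(2 * (σ : ℂ) - 1))) /
        ((1 - (v.residueCard : ℂ) ^ (-((σ : ℂ) - 1))) * (1 - (quadraticHeckeCharCM L).valueAtUniformizer v * (v.residueCard : ℂ) ^ (-((σ : ℂ) - 1))) *
          (1 - (quadraticHeckeCharCM L).valueAtUniformizer v * (v.residueCard : ℂ) ^ (-(2 * (σ : ℂ) - 2)))) := by
  haveI : Algebra.IsQuadraticExtension ↥(maximalRealSubfield L) L := IsCMField.isQuadraticExtension L
  obtain ⟨he, hq⟩ := placesOver_good L v hunr w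
  have hν : ν.real (primePowBall (v.adicCompletion ↥(maximalRealSubfield L)) 0) ≠ 0 := (LocalFieldHaar.measureReal_primePowBall_pos ν 0).ne'
  rw [integral_complex_ofReal, integral_localHeight_rpow_eq_localScalar_of_nonsplit L (IsCMField.complexConj L) hcδ hδ hd v w ν hw he h2 hδu (hq hw) hσ,
    pi_integralBox_toReal L v ν, valueAtUniformizer_quadraticHeckeCharCM_of_nonsplit L v w hw hunr, Complex.real_smul, Complex.ofReal_mul,
    ← mul_assoc, ← Complex.ofReal_mul, inv_mul_cancel₀ (pow_ne_zero 3 hν), Complex.ofReal_one, one_mul,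
    ofReal_localScalarShape (Nat.cast_nonneg _) σ (-1)]
  push_cast
  ring_nf

include hd in
/-- **THE LOCAL MEAN AT A GOOD SPLIT PLACE IS FILE 1's `v`-FACTOR** (`σ > 1` real; `ε_v = +1`, ★ `valueAtUniformizer_quadraticHeckeCharCM_of_split`; the integral is ★ (3-ii)
`K2E1IntertwiningLocalMeanSplitU3.integral_splitCell_pi_eq_localScalar`, K2-defs1 (g5)). [cite: Langlands1971, §3] [cite: MoeglinWaldspurger1995, II.1.7] -/
theorem localMean_eq_localScalar_of_split (w : PlacesOver L v) (hw : IsCMField.complexConj L • w.1 ≠ w.1)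
    (h2 : Valued.v (2 : v.adicCompletion ↥(maximalRealSubfield L)) = 1) (hδu : Valued.v (algebraMap L (LocalRing L v) δ w) = 1) {σ : ℝ} (hσ : 1 < σ) :
    ((Measure.pi fun _ : Fin 3 => ν) (integralBox ↥(maximalRealSubfield L) (Fin 3) v)).toReal⁻¹ •
      ∫ p : Fin 3 → v.adicCompletion ↥(maximalRealSubfield L),
        (((∏ w' : PlacesOver L v, max 1 (max ((normAbs (w'.1.adicCompletion L) (quadraticLocalEquiv L v (IsCMField.complexConj L) hcδ hδ (p 0, p 1) w') : ℝ≥0) : ℝ)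
          ((normAbs (w'.1.adicCompletion L) ((toLocalRing L v (p 2) * algebraMap L (LocalRing L v) δ -
            toLocalRing L v 2⁻¹ * (quadraticLocalEquiv L v (IsCMField.complexConj L) hcδ hδ (p 0, p 1) *
              conjLocal L (IsCMField.complexConj L) v (quadraticLocalEquiv L v (IsCMField.complexConj L) hcδ hδ (p 0, p 1)))) w') : ℝ≥0) : ℝ))) ^ (-σ) : ℝ) : ℂ)
        ∂(Measure.pi fun _ : Fin 3 => ν) =
      (1 - (v.residueCard : ℂ) ^ (-(σ : ℂ))) * (1 - (quadraticHeckeCharCM L).valueAtUniformizer v * (v.residueCard : ℂ) ^ (-(σ : ℂ))) *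
          (1 - (quadraticHeckeCharCM L).valueAtUniformizer v * (v.residueCard : ℂ) ^ (-(2 * (σ : ℂ) - 1))) /
        ((1 - (v.residueCard : ℂ) ^ (-((σ : ℂ) - 1))) * (1 - (quadraticHeckeCharCM L).valueAtUniformizer v * (v.residueCard : ℂ) ^ (-((σ : ℂ) - 1))) *
          (1 - (quadraticHeckeCharCM L).valueAtUniformizer v * (v.residueCard : ℂ) ^ (-(2 * (σ : ℂ) - 2)))) := by
  have hν : ν.real (primePowBall (v.adicCompletion ↥(maximalRealSubfield L)) 0) ≠ 0 := (LocalFieldHaar.measureReal_primePowBall_pos ν 0).ne'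
  rw [integral_complex_ofReal, integral_localHeight_rpow_eq_localScalar_of_split L hcδ hδ hd v ν w hw h2 hδu hσ,
    pi_integralBox_toReal L v ν, valueAtUniformizer_quadraticHeckeCharCM_of_split L v w hw, Complex.real_smul, Complex.ofReal_mul,
    ← mul_assoc, ← Complex.ofReal_mul, inv_mul_cancel₀ (pow_ne_zero 3 hν), Complex.ofReal_one, one_mul,
    ofReal_localScalarShape (Nat.cast_nonneg _) σ 1]
  push_cast
  ring_nf

include hd in
/-- **THE LOCAL MEAN AT EVERY GOOD PLACE IS FILE 1's `v`-FACTOR** (`v` unramified in `L`, `|2|_v = 1`, all `δ_w` units; `σ > 1` real):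
`(ν(𝒪_v³))⁻¹ • ∫ ((Q_v^{−σ} : ℝ) : ℂ) d(ν⊗ν⊗ν)` is LITERALLY the `v`-term of ★ `K2E1IntertwiningScalarContinuationU3.hasProd_localScalar_three_cm` at `σ ↦ (σ : ℂ)` — the local
input of the finite Euler product (3-iii-b2) via ★ `AdelicProductIntegral.hasProd_localIntegral_of_integrable`. [cite: Langlands1971, §3] [cite: Rogawski1990, §4.5] [cite: MoeglinWaldspurger1995, IV.1.11] -/
theorem localMean_eq_localScalar (hunr : Algebra.IsUnramifiedIn (𝓞 L) v.asIdeal) (h2 : Valued.v (2 : v.adicCompletion ↥(maximalRealSubfield L)) = 1)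
    (hδu : ∀ w : PlacesOver L v, Valued.v (algebraMap L (LocalRing L v) δ w) = 1) {σ : ℝ} (hσ : 1 < σ) :
    ((Measure.pi fun _ : Fin 3 => ν) (integralBox ↥(maximalRealSubfield L) (Fin 3) v)).toReal⁻¹ •
      ∫ p : Fin 3 → v.adicCompletion ↥(maximalRealSubfield L),
        (((∏ w' : PlacesOver L v, max 1 (max ((normAbs (w'.1.adicCompletion L) (quadraticLocalEquiv L v (IsCMField.complexConj L) hcδ hδ (p 0, p 1) w') : ℝ≥0) : ℝ)
          ((normAbs (w'.1.adicCompletion L) ((toLocalRing L v (p 2) * algebraMap L (LocalRing L v) δ -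
            toLocalRing L v 2⁻¹ * (quadraticLocalEquiv L v (IsCMField.complexConj L) hcδ hδ (p 0, p 1) *
              conjLocal L (IsCMField.complexConj L) v (quadraticLocalEquiv L v (IsCMField.complexConj L) hcδ hδ (p 0, p 1)))) w') : ℝ≥0) : ℝ))) ^ (-σ) : ℝ) : ℂ)
        ∂(Measure.pi fun _ : Fin 3 => ν) =
      (1 - (v.residueCard : ℂ) ^ (-(σ : ℂ))) * (1 - (quadraticHeckeCharCM L).valueAtUniformizer v * (v.residueCard : ℂ) ^ (-(σ : ℂ))) *
          (1 - (quadraticHeckeCharCM L).valueAtUniformizer v * (v.residueCard : ℂ) ^ (-(2 * (σ : ℂ) - 1))) /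
        ((1 - (v.residueCard : ℂ) ^ (-((σ : ℂ) - 1))) * (1 - (quadraticHeckeCharCM L).valueAtUniformizer v * (v.residueCard : ℂ) ^ (-((σ : ℂ) - 1))) *
          (1 - (quadraticHeckeCharCM L).valueAtUniformizer v * (v.residueCard : ℂ) ^ (-(2 * (σ : ℂ) - 2)))) := by
  obtain ⟨w⟩ := PlacesOver.nonempty L v
  by_cases hw : IsCMField.complexConj L • w.1 = w.1
  · exact localMean_eq_localScalar_of_nonsplit L hcδ hδ hd v ν hunr w hw h2 (hδu w) hσ
  · exact localMean_eq_localScalar_of_split L hcδ hδ hd v ν w hw h2 (hδu w) hσ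

end Mean

end Summit.HodgeConjecture.HodgeConjecture.Cruxes.H413.K2E1IntertwiningLocalMeanCMU3

end
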